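import Literature.AnabelianGeometry.SemiGraphs.ArithThm54CharCoresOfDesignData
import Literature.AnabelianGeometry.SemiGraphs.ArithLevelKerCongruenceSelfNormalizingChart
import Literature.AnabelianGeometry.SemiGraphs.ArithBranchPairAugChartModKernel
import Literature.AnabelianGeometry.SemiGraphs.ArithLevelKernelVertexLift
import Literature.AnabelianGeometry.SemiGraphs.ArithLevelCofinalityOuterAction
import Literature.AnabelianGeometry.SemiGraphs.ArithVertGpCompact
import Literature.AnabelianGeometry.SemiGraphs.TemperedEdgeLikeDistinctProofs
import Literature.AnabelianGeometry.SemiGraphs.TemperedReconstructionReductionsProofs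
import HarnessLib

/-!
# [SemiAnbd] Thm 5.4 (i) ∧ (ii) AT `π₁^temp(𝒢) ⋊^out Π_A` OF THE CHARACTERISTIC GALOIS TOWER — CAPSTONE v6:
# the DESIGN inputs reduced to vertex transport `hV`, branch transport `hBR`, congruence-continuity `hCC`

Mochizuki, *Semi-graphs of anabelioids*, Publ. RIMS **42** (2006) 221–322, §5 Thm 5.4 (i)(ii), manuscript p. 66
(l. 50: "the proofs are entirely parallel to those of Theorem 3.7, Corollary 3.9"); Rmk 5.3.1 p. 65; Def 5.1 (i)
p. 62; Prop 5.2 (i)/(iv) pp. 63–64; Prop 3.6 (iv) p. 39; Thm 3.7 (i)/(ii) p. 40, (iii) p. 41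
[cite: MochizukiSemiAnbd2006, Thm 5.4 (i), p. 66].

PROOF-ONLY file (abc-iut cell, layer L3, producer row T54-B = `plan/GAP-LEDGER.md` G-w4d053-1; seat
abc-iut-w4-d029 gen 5, row «T54·CAPSTONE-v4@char-tower», third file).  No definition, no new named fact, no
producer restated — every input is consumed BY NAME.  Successor of this seat's v5 (ArithThm54CharCoresCapstoneV5.lean
p444735): the composition is unchanged ((AI4″) `stabBranchPairAug` via abc-iut-w4-d059's
`stabBranchPairAug_chart_outerAction_modKernel` p442253 with `haugc`/`hLopen` abc-iut-w6-d070, `hVc := hVc_of_cosetTower`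
abc-iut-w4-d059 p442845, `hUclosed` / `hU := hU_arithVertGp_outerAction` abc-iut-w4-d085 p442216, `hnobpNCpt`
abc-iut-w4-d053 ∘ (I0v); `hK1′ := GaloisLevelData.hK1'_chart_of_eventually_congruenceContinuous` abc-iut-w6-d117
p442489; capstone `…_chart_of_producers_levelTopology` abc-iut-w4-d089 p437233), and TWO of the design-data binders
are now DERIVED inside:

* `hE` (Prop 3.6 (iv) at `ρ_𝔾(a)` for EDGE-LIKE subgroups) ⟸ `hBR` (branch transport): an edge-like subgroup of `e`
  is `g·ψ(Π_b)·g⁻¹` for a branch `b : e → v` and ANY verticial `ψ` at `v` (`edgeLike_eq_map_branchSubgroup`,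
  TemperedEdgeLikeDistinctProofs.lean — Thm 3.7 (iii)); a representative `Φ` of `ρ′ a` given by `hBR` carries
  `ψ(Π_b)` to `x′·ψ′(Π_{a·b})·x′⁻¹` with `ψ′` verticial at `a·v`, and `ψ′(Π_{a·b})` is edge-like for the edge of
  `a·b` (`isEdgeHom_comp_brHom`, TemperedReconstructionReductionsProofs.lean), i.e. for `a·e`
  (`Hom.edgeOf_branchMap`); conjugates of edge-like subgroups are edge-like (`conj_mem_edgeLikeSubgroups'`).
* `hopen` (Def 5.1 (i)(c): an open subgroup of `Π_A` acts trivially on the underlying semi-graph) ⟸ `hCC` at depth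
  `n₁`: `ker baseAct` contains a neighbourhood of `1`, so it is an open subgroup (`Subgroup.isOpen_of_mem_nhds`).

* `arithMaximalCompactStatement_outerAction_piPresentation_chart_of_designData_hCC_v6` — at the chart `D.chart …` of
  ANY cofinal Galois tower `D` with characteristic finite levels (`hker`) and (I0v) (`hfaithV`), level topology pinned;
* `arithMaximalCompactStatement_outerAction_piPresentation_charCores_of_designData_hCC_v6` — **CAPSTONE v6** at
  abc-iut-w4-d048's characteristic tower `GaloisLevelData.ofCharCores h36 v₀ hVt hEt` (`d := id`,
  `hker := ofCharCores_ker_piLevelAut_eq_charOpenCore` p440359, `hfaithV := faithfulV_ofCharCores` p437588).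

HONEST RESIDUAL of CAPSTONE v6 (explicit binders; owners): DESIGN data = vertex transport `hV` and branch transport
`hBR` (Prop 3.6 (iv) at `ρ_𝔾(a)` / Def 5.1 (i); abc-iut-w4-d082's currency — `hBR` implies `hV` at every vertex
carrying a branch, `hV` is kept for branchless vertices) and `n₁`/`hCC` (Def 5.1 (i)(c)/(d) + Prop 5.2 (i):
congruence-continuity of the outer action at the deep tree levels with trivial base action near `1` — DESIGN,
abc-iut-w6-d117's label); `hRcV`/`hRcB` (the §3 representatives are those read off the presentation;
`exists_chartRepresentatives_of_presentation`; the «Rc-INVARIANCE» row — abc-iut-w4-d089 g7 p444904 edge half — may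
remove them, the transport of `hest` across representatives being the remaining point); the topology pin `hinst`
(`rfl` at consumers); Thm 5.4's printed frame `noSwitchBase`; Thm 5.4's OWN hypotheses `hest` (total arithmetic
estrangement; FALSE at split actions — abc-iut-w6-d072 p433406) and `hbot` (⟸ `[Infinite Π_A]`,
`not_isArithAmple_bot_of_compactSpace`); the §5 frame `[CompactSpace Π_A] [TotallyDisconnectedSpace Π_A]`; Def 5.1 (i)
coherence `[Finite Vertex] [Finite Branch] [Finite Edge]`, `hVt`, `hEt`; base vertex `v₀`; the Thm 3.7 hypotheses
`h37` and `hG`.  GONE relative to p440359: `stabBranchPairAug`, `hK1′`; v4→v5: `hself`, `hR`, `hnobp`; v5→v6: `hE`,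
`hopen`.  Nothing beyond composition and the two derivations is proved here; typed ≠ proved for the residual
inputs; this is Thm 5.4 for OUR tower decomposition; no side taken on [IUTchIII] Cor. 3.12.
-/

namespace Literature.AnabelianGeometry.SemiGraphs

namespace ProfiniteSemiGraph

open CategoryTheory CategoryTheory.PreGaloisCategory Topology Filter Literature.AnabelianGeometry.Anabelioids
open Literature.AnabelianGeometry.EtaleTheta
open Literature.AnabelianGeometry.AbsoluteAnabelian (IsTopologicallyFinitelyGenerated)
open scoped Pointwise FintypeCatDiscrete

universe u

variable {𝒢 : ProfiniteSemiGraph.{u}}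

section Chart

variable (D : GaloisLevelData 𝒢)
  (hcof : ∀ (T : CovObj 𝒢), T.IsTempered → ∀ p : T.Point,
    ∃ i : ℕ, ∀ j, i ≤ j → (D.S j).Splits (T.component p))
  (hcn : 𝒢.graph.IsConnected) (hS : ∀ n, (D.S n).Splits (D.S n)) (hfin : ∀ n, (D.S n).IsFinite)
  (hne : ∀ n, (D.S n).HasNonemptyFibres)
  (hconn : ∀ (n : ℕ) (p q : (D.S n).Point), (D.S n).SameComponent p q)

/-- **[SemiAnbd] Thm 5.4 (i) ∧ (ii) at `π₁^temp(𝒢) ⋊^out Π_A` for the chart of a cofinal Galois tower with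
characteristic levels, level topology pinned — design data REDUCED to vertex transport `hV`, branch transport `hBR`
and congruence-continuity `hCC`**: this seat's v5 `…_chart_of_designData_hCC` (p444735) with the Prop 3.6 (iv) EDGE
transport `hE` DERIVED from `hBR` (an edge-like subgroup of `e` is a conjugate of `ψ(Π_b)` for a branch `b` of `e`,
`edgeLike_eq_map_branchSubgroup`, Thm 3.7 (iii); `hBR` carries it to a conjugate of `ψ′(Π_{a·b})`, edge-like for `a·e`
by `isEdgeHom_comp_brHom`) and Def 5.1 (i)(c) `hopen` DERIVED from `hCC` (`ker baseAct` contains a neighbourhood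
of `1`, hence is an open subgroup).  (AI4″) via abc-iut-w4-d059 p442253 / abc-iut-w4-d085 p442216 / abc-iut-w6-d070,
`hK1′` via abc-iut-w6-d117 p442489, capstone via abc-iut-w4-d089 p437233 — all BY NAME as in v5.  Residual: `hV`,
`hBR`, `hRcV`/`hRcB`, `hker`, `hfaithV`, `n₁`/`hCC`, `hinst`, `noSwitchBase`, `hest`, `hbot`.
[cite: MochizukiSemiAnbd2006, Thm 5.4 (i), p. 66] -/
theorem arithMaximalCompactStatement_outerAction_piPresentation_chart_of_designData_hCC_v6
    (h37 : 𝒢.Thm37Hypotheses) (hG : 𝒢.graph.IsGraph) [Finite 𝒢.graph.Vertex] [Finite 𝒢.graph.Branch]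
    [Finite 𝒢.graph.Edge]
    {PA : Type u} [Group PA] [TopologicalSpace PA] [IsTopologicalGroup PA] [CompactSpace PA]
    [TotallyDisconnectedSpace PA]
    (ρ' : PA →* TopOut (D.chart h37.toProp36Hypotheses.isCountable hcof hcn hS hfin hne).G) (baseAct : PA →* Aut 𝒢.graph)
    [inst : TopologicalSpace (outerSemidirectProduct ρ')]
    (T : ∀ w : 𝒢.graph.Vertex, D.PointSeq h37.toProp36Hypotheses.isCountable w) (R : SemiGraph.RefBranches 𝒢.graph)
    -- §3 representatives MATCHED to the presentation (abc-iut-w4-d059's `hRcV`/`hRcB`)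
    (Rc : ChartRepresentatives (D.chart h37.toProp36Hypotheses.isCountable hcof hcn hS hfin hne))
    (hRcV : ∀ v, Rc.Hv v = (D.piPresentation h37.toProp36Hypotheses.isCountable T R).H v)
    (hRcB : ∀ b, Rc.Hb b = ((D.piPresentation h37.toProp36Hypotheses.isCountable T R).M (𝒢.graph.edgeOf b)).map
      (MulAut.conj ((D.piPresentation h37.toProp36Hypotheses.isCountable T R).s b)).toMonoidHom)
    -- Prop 3.6 (iv) at `ρ_𝔾(a)` / Def 5.1 (i): the DESIGN data of the outer model (abc-iut-w4-d082's currency) — vertex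
    -- transport `hV` and branch transport `hBR` (edge transport `hE` and `hopen` are DERIVED inside)
    (hV : ∀ (a : PA) (v : 𝒢.graph.Vertex) (H : Subgroup (D.chart h37.toProp36Hypotheses.isCountable hcof hcn hS hfin hne).G), H ∈ verticialSubgroups (D.chart h37.toProp36Hypotheses.isCountable hcof hcn hS hfin hne) v →
      ∃ φ : contMulAut (D.chart h37.toProp36Hypotheses.isCountable hcof hcn hS hfin hne).G, TopOut.mk _ φ = ρ' a ∧
        H.map (φ : MulAut (D.chart h37.toProp36Hypotheses.isCountable hcof hcn hS hfin hne).G).toMonoidHom ∈ verticialSubgroups (D.chart h37.toProp36Hypotheses.isCountable hcof hcn hS hfin hne) ((baseAct a).hom.vertexMap v))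
    (hBR : ∀ (a : PA) (b : 𝒢.graph.Branch) (v : 𝒢.graph.Vertex) (hb : 𝒢.graph.abuts b = some v)
      (φ : 𝒢.Gv v →ₜ* (D.chart h37.toProp36Hypotheses.isCountable hcof hcn hS hfin hne).G), IsVerticialHom (D.chart h37.toProp36Hypotheses.isCountable hcof hcn hS hfin hne) v φ →
      ∃ Φ : contMulAut (D.chart h37.toProp36Hypotheses.isCountable hcof hcn hS hfin hne).G, TopOut.mk _ Φ = ρ' a ∧
        ∃ φ' : 𝒢.Gv ((baseAct a).hom.vertexMap v) →ₜ* (D.chart h37.toProp36Hypotheses.isCountable hcof hcn hS hfin hne).G,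
          IsVerticialHom (D.chart h37.toProp36Hypotheses.isCountable hcof hcn hS hfin hne) ((baseAct a).hom.vertexMap v) φ' ∧
          ∃ x' : (D.chart h37.toProp36Hypotheses.isCountable hcof hcn hS hfin hne).G,
            Subgroup.map (Φ : MulAut (D.chart h37.toProp36Hypotheses.isCountable hcof hcn hS hfin hne).G).toMonoidHom φ.toMonoidHom.range =
              Subgroup.map (MulAut.conj x').toMonoidHom φ'.toMonoidHom.range ∧
            Subgroup.map (Φ : MulAut (D.chart h37.toProp36Hypotheses.isCountable hcof hcn hS hfin hne).G).toMonoidHom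
                (Subgroup.map φ.toMonoidHom (𝒢.branchSubgroup b v hb)) =
              Subgroup.map (MulAut.conj x').toMonoidHom
                (Subgroup.map φ'.toMonoidHom
                  (𝒢.branchSubgroup ((baseAct a).hom.branchMap b) ((baseAct a).hom.vertexMap v)
                    ((baseAct a).hom.abuts_branchMap b v hb))))
    (w₀ : 𝒢.graph.Vertex)
    -- CHARACTERISTIC finite levels (abc-iut-L3-t9 E1): `ker π_n` is the characteristic open core of level `d n`
    (d : ℕ → ℕ) (hker : ∀ n, (D.piLevelAut h37.toProp36Hypotheses.isCountable hconn n).ker = charOpenCore (D.temperedPi h37.toProp36Hypotheses.isCountable) (d n))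
    -- (I0v) for the tower `D` (abc-iut-w4-d053)
    (hfaithV : ∀ (v : 𝒢.graph.Vertex) (h : 𝒢.Gv v),
      (∀ (n : ℕ) (x : ((D.S n).SV v).obj.V), ((D.S n).SV v).obj.ρ h x = x) → h = 1)
    -- the continuity binder `hK1′` REDUCED (abc-iut-w6-d117 p442489 / abc-iut-w4-d089 p440870): beyond depth `n₁` the
    -- outer action is CONGRUENCE-CONTINUOUS with trivial base action near `1` (`hCC`, Def 5.1 (i)(c)/(d) — DESIGN);
    -- `hself` is abc-iut-w6-d117's THEOREM `exists_forall_piPresentation_hself_chart` (no binder)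
    (n₁ : ℕ)
    (hCC : ∀ n, n₁ ≤ n → ∃ U ∈ 𝓝 (1 : PA), ∀ a ∈ U, baseAct a = 1 ∧
      ∃ φ : contMulAut (D.chart h37.toProp36Hypotheses.isCountable hcof hcn hS hfin hne).G, TopOut.mk (D.chart h37.toProp36Hypotheses.isCountable hcof hcn hS hfin hne).G φ = ρ' a ∧
        ∀ y : (D.chart h37.toProp36Hypotheses.isCountable hcof hcn hS hfin hne).G, (φ : MulAut (D.chart h37.toProp36Hypotheses.isCountable hcof hcn hS hfin hne).G) y * y⁻¹ ∈
          (D.projAut h37.toProp36Hypotheses.isCountable n).ker)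
    -- the topology of `E` IS abc-iut-w6-d070's tempered level topology at the chart of the tower (`hK1′` := the
    -- term derived from `hCC`, abc-iut-w6-d117 p442489)
    (hinst : inst = @arithLevelTopology 𝒢 (D.chart h37.toProp36Hypotheses.isCountable hcof hcn hS hfin hne) PA _ _ _ ρ' baseAct
        (TemperedPiChart.firstCountableTopology_G (D.chart h37.toProp36Hypotheses.isCountable hcof hcn hS hfin hne)) h37.toProp36Hypotheses IsTempered.of_profinite (D.piPresentation h37.toProp36Hypotheses.isCountable T R)
        (isArithCompatible_piPresentation_outerAction_of_branchPair_chart_of_finite D h37.toProp36Hypotheses.isCountable hcof hcn hS hfin hne T R ρ' baseAct h37 hG hV hBR) w₀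
        (D.isCompact_piPresentation_H h37.toProp36Hypotheses.isCountable T R w₀) (fun n => (D.projAut h37.toProp36Hypotheses.isCountable n).ker) (fun _ => MonoidHom.normal_ker _)
        (D.hKst_and_hLst_of_ker_piLevelAut_eq_charOpenCore h37.toProp36Hypotheses.isCountable hconn T R ρ' (isArithCompatible_piPresentation_outerAction_of_branchPair_chart_of_finite D h37.toProp36Hypotheses.isCountable hcof hcn hS hfin hne T R ρ' baseAct h37 hG hV hBR) d hker).1
        (D.ker_projAut_anti h37.toProp36Hypotheses.isCountable) (D.isOpen_ker_projAut h37.toProp36Hypotheses.isCountable) (fun _ hU => D.exists_ker_projAut_subset h37.toProp36Hypotheses.isCountable hU) (D.hK1'_chart_of_eventually_congruenceContinuous h37 hcof hcn hS hfin hne T R hconn ρ' baseAct (isArithCompatible_piPresentation_outerAction_of_branchPair_chart_of_finite D h37.toProp36Hypotheses.isCountable hcof hcn hS hfin hne T R ρ' baseAct h37 hG hV hBR) d hker hG n₁ hCC))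
    (noSwitchBase : NoBranchSwitching 𝒢.graph.edgeOf
      (fun (a : PA) (b : 𝒢.graph.Branch) => (baseAct a).hom.branchMap b))
    (hest : IsTotallyArithEstranged (decompositionDataOfChart Rc (toOuterSemidirectProduct ρ')) (outerSemidirectProductSnd ρ')) (hbot : ¬ IsArithAmple (outerSemidirectProductSnd ρ') ⊥) :
    ArithMaximalCompactStatementI (decompositionDataOfChart Rc (toOuterSemidirectProduct ρ')) (outerSemidirectProductSnd ρ') ∧
      ArithMaximalCompactStatementII (decompositionDataOfChart Rc (toOuterSemidirectProduct ρ')) (outerSemidirectProductSnd ρ') := by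
  subst hinst
  -- `hopen` (Def 5.1 (i)(c): an open subgroup of `Π_A` acts trivially on the underlying semi-graph) FOLLOWS from
  -- `hCC` at depth `n₁`: `ker baseAct` contains a neighbourhood of `1`, hence is open
  have hopen : ∃ U : Subgroup PA, IsOpen (U : Set PA) ∧ ∀ a ∈ U,
      (∀ v, (baseAct a).hom.vertexMap v = v) ∧ (∀ e, (baseAct a).hom.edgeMap e = e) ∧
        ∀ b, (baseAct a).hom.branchMap b = b := by
    obtain ⟨U, hU, hUa⟩ := hCC n₁ le_rfl
    refine ⟨baseAct.ker, baseAct.ker.isOpen_of_mem_nhds (g := 1)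
      (Filter.mem_of_superset hU fun a ha => (MonoidHom.mem_ker).mpr (hUa a ha).1), fun a ha => ?_⟩
    rw [(MonoidHom.mem_ker).mp ha]
    exact ⟨SemiGraph.aut_one_vertexMap, SemiGraph.aut_one_edgeMap, SemiGraph.aut_one_branchMap⟩
  -- `hE` (edge transport, Prop 3.6 (iv)) FOLLOWS from `hBR` (branch transport): an edge-like subgroup of `e` is a
  -- conjugate of `ψ(Π_b)` for a branch `b` of `e` at `v` and ANY verticial `ψ` at `v` (`edgeLike_eq_map_branchSubgroup`,
  -- Thm 3.7 (iii)); `hBR` carries `ψ(Π_b)` to a conjugate of `ψ′(Π_{a·b})`, edge-like for `a·e` (`isEdgeHom_comp_brHom`)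
  have hE : ∀ (a : PA) (e : 𝒢.graph.Edge) (K : Subgroup (D.chart h37.toProp36Hypotheses.isCountable hcof hcn hS hfin hne).G), K ∈ edgeLikeSubgroups (D.chart h37.toProp36Hypotheses.isCountable hcof hcn hS hfin hne) e →
      ∃ φ : contMulAut (D.chart h37.toProp36Hypotheses.isCountable hcof hcn hS hfin hne).G, TopOut.mk _ φ = ρ' a ∧
        K.map (φ : MulAut (D.chart h37.toProp36Hypotheses.isCountable hcof hcn hS hfin hne).G).toMonoidHom ∈ edgeLikeSubgroups (D.chart h37.toProp36Hypotheses.isCountable hcof hcn hS hfin hne) ((baseAct a).hom.edgeMap e) := by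
    intro a e K hK
    obtain ⟨b, b₂, -, hbe, -, -⟩ := 𝒢.graph.two_branches e
    obtain ⟨v, hb⟩ := Option.isSome_iff_exists.mp (hG.abuts_isSome b)
    subst hbe
    obtain ⟨g, rfl⟩ := edgeLike_eq_map_branchSubgroup (D.chart h37.toProp36Hypotheses.isCountable hcof hcn hS hfin hne) hb hK (T v).decompHomCont
      ((T v).isVerticialHom_decompHomCont_chart hcof hcn hS hfin hne)
    obtain ⟨Φ, hΦ, φ', hφ', x', -, hbr⟩ := hBR a b v hb (T v).decompHomCont
      ((T v).isVerticialHom_decompHomCont_chart hcof hcn hS hfin hne)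
    refine ⟨Φ, hΦ, ?_⟩
    have hcomm : (((𝒢.branchSubgroup b v hb).map (T v).decompHomCont.toMonoidHom).map
        (MulAut.conj g).toMonoidHom).map (Φ : MulAut (D.chart h37.toProp36Hypotheses.isCountable hcof hcn hS hfin hne).G).toMonoidHom =
        ((((𝒢.branchSubgroup b v hb).map (T v).decompHomCont.toMonoidHom).map
          (Φ : MulAut (D.chart h37.toProp36Hypotheses.isCountable hcof hcn hS hfin hne).G).toMonoidHom).map (MulAut.conj ((Φ : MulAut (D.chart h37.toProp36Hypotheses.isCountable hcof hcn hS hfin hne).G) g)).toMonoidHom) := by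
      rw [Subgroup.map_map, Subgroup.map_map]
      congr 1
      ext y
      simp [map_mul, map_inv]
    -- `x'·ψ′(Π_{a·b})·x'⁻¹` conjugated by `Φ g` is edge-like for the edge of `a·b` …
    have key : (((𝒢.branchSubgroup ((baseAct a).hom.branchMap b) ((baseAct a).hom.vertexMap v)
          ((baseAct a).hom.abuts_branchMap b v hb)).map φ'.toMonoidHom).map (MulAut.conj x').toMonoidHom).map
        (MulAut.conj ((Φ : MulAut (D.chart h37.toProp36Hypotheses.isCountable hcof hcn hS hfin hne).G) g)).toMonoidHom ∈
        edgeLikeSubgroups (D.chart h37.toProp36Hypotheses.isCountable hcof hcn hS hfin hne) (𝒢.graph.edgeOf ((baseAct a).hom.branchMap b)) :=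
      conj_mem_edgeLikeSubgroups' _ (conj_mem_edgeLikeSubgroups' _
        ⟨φ'.comp (𝒢.brHom _ _ ((baseAct a).hom.abuts_branchMap b v hb)),
          isEdgeHom_comp_brHom _ ((baseAct a).hom.abuts_branchMap b v hb) hφ', (MonoidHom.range_comp _ _).symm⟩ _) _
    -- … which is `a·e` (naturality of `edgeOf`), and the subgroup is `Φ(g·ψ(Π_b)·g⁻¹)` by `hcomm`/`hbr`
    have hAB := hcomm.trans (congrArg (fun Z => Z.map (MulAut.conj ((Φ : MulAut (D.chart h37.toProp36Hypotheses.isCountable hcof hcn hS hfin hne).G) g)).toMonoidHom) hbr)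
    exact (congrArg₂ (fun (Z : Subgroup (D.chart h37.toProp36Hypotheses.isCountable hcof hcn hS hfin hne).G) (ε : 𝒢.graph.Edge) => Z ∈ edgeLikeSubgroups (D.chart h37.toProp36Hypotheses.isCountable hcof hcn hS hfin hne) ε) hAB
      ((baseAct a).hom.edgeOf_branchMap b).symm).mpr key
  -- exactness of `1 → π₁^temp → E → Π_A → 1` (temp-slimness) at the chart of the tower; the inner action
  obtain ⟨hι, hex, -⟩ := outerAction_exact (D.chart h37.toProp36Hypotheses.isCountable hcof hcn hS hfin hne) ρ' h37.toProp36Hypotheses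
  have hιΦ : ∀ g : (D.chart h37.toProp36Hypotheses.isCountable hcof hcn hS hfin hne).G, (((contMulAut (D.chart h37.toProp36Hypotheses.isCountable hcof hcn hS hfin hne).G).subtype.comp (MonoidHom.fst (contMulAut (D.chart h37.toProp36Hypotheses.isCountable hcof hcn hS hfin hne).G) PA)).comp (outerSemidirectProduct ρ').subtype) ((toOuterSemidirectProduct ρ') g) = MulAut.conj g := fun _ => rfl
  have hισ : ∀ g : (D.chart h37.toProp36Hypotheses.isCountable hcof hcn hS hfin hne).G, (baseAct.comp (outerSemidirectProductSnd ρ')) ((toOuterSemidirectProduct ρ') g) = 1 := fun g => by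
    have hg : (toOuterSemidirectProduct ρ') g ∈ (outerSemidirectProductSnd ρ').ker := hex ▸ ⟨g, rfl⟩
    rw [MonoidHom.comp_apply, (MonoidHom.mem_ker).mp hg, map_one]
  have hPH : ∀ w, (D.piPresentation h37.toProp36Hypotheses.isCountable T R).H w ∈ verticialSubgroups (D.chart h37.toProp36Hypotheses.isCountable hcof hcn hS hfin hne) w := fun w => by
    rw [D.piPresentation_H h37.toProp36Hypotheses.isCountable T R]
    exact (T w).range_decompHom_mem_verticialSubgroups_chart hcof hcn hS hfin hne
  have hHc := fun w => D.isCompact_piPresentation_H h37.toProp36Hypotheses.isCountable T R w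
  haveI hNn : ∀ n : ℕ, @Subgroup.Normal (D.chart h37.toProp36Hypotheses.isCountable hcof hcn hS hfin hne).G (D.chart h37.toProp36Hypotheses.isCountable hcof hcn hS hfin hne).group ((D.projAut h37.toProp36Hypotheses.isCountable n).ker) :=
    fun _ => MonoidHom.normal_ker _
  haveI hLn : ∀ n : ℕ, @Subgroup.Normal (D.chart h37.toProp36Hypotheses.isCountable hcof hcn hS hfin hne).G (D.chart h37.toProp36Hypotheses.isCountable hcof hcn hS hfin hne).group ((D.piLevelAut h37.toProp36Hypotheses.isCountable hconn n).ker) :=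
    fun _ => MonoidHom.normal_ker _
  -- `hK1′` DERIVED from `hCC` alone (abc-iut-w6-d117 p442489: `hself` discharged at the chart of any tower)
  have hK1' := (D.hK1'_chart_of_eventually_congruenceContinuous h37 hcof hcn hS hfin hne T R hconn ρ' baseAct (isArithCompatible_piPresentation_outerAction_of_branchPair_chart_of_finite D h37.toProp36Hypotheses.isCountable hcof hcn hS hfin hne T R ρ' baseAct h37 hG hV hBR) d hker hG n₁ hCC)
  -- the level topology and its package (abc-iut-w6-d070)
  haveI hfc : FirstCountableTopology (D.chart h37.toProp36Hypotheses.isCountable hcof hcn hS hfin hne).G := TemperedPiChart.firstCountableTopology_G _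
  letI : TopologicalSpace (outerSemidirectProduct ρ') := @arithLevelTopology 𝒢 (D.chart h37.toProp36Hypotheses.isCountable hcof hcn hS hfin hne) PA _ _ _ ρ' baseAct
        (TemperedPiChart.firstCountableTopology_G (D.chart h37.toProp36Hypotheses.isCountable hcof hcn hS hfin hne)) h37.toProp36Hypotheses IsTempered.of_profinite (D.piPresentation h37.toProp36Hypotheses.isCountable T R)
        (isArithCompatible_piPresentation_outerAction_of_branchPair_chart_of_finite D h37.toProp36Hypotheses.isCountable hcof hcn hS hfin hne T R ρ' baseAct h37 hG hV hBR) w₀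
        (D.isCompact_piPresentation_H h37.toProp36Hypotheses.isCountable T R w₀) (fun n => (D.projAut h37.toProp36Hypotheses.isCountable n).ker) (fun _ => MonoidHom.normal_ker _)
        (D.hKst_and_hLst_of_ker_piLevelAut_eq_charOpenCore h37.toProp36Hypotheses.isCountable hconn T R ρ' (isArithCompatible_piPresentation_outerAction_of_branchPair_chart_of_finite D h37.toProp36Hypotheses.isCountable hcof hcn hS hfin hne T R ρ' baseAct h37 hG hV hBR) d hker).1
        (D.ker_projAut_anti h37.toProp36Hypotheses.isCountable) (D.isOpen_ker_projAut h37.toProp36Hypotheses.isCountable) (fun _ hU => D.exists_ker_projAut_subset h37.toProp36Hypotheses.isCountable hU) hK1'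
  haveI := arithLevelTopology_isTopologicalGroup (D.chart h37.toProp36Hypotheses.isCountable hcof hcn hS hfin hne) ρ' baseAct h37.toProp36Hypotheses IsTempered.of_profinite (D.piPresentation h37.toProp36Hypotheses.isCountable T R) (isArithCompatible_piPresentation_outerAction_of_branchPair_chart_of_finite D h37.toProp36Hypotheses.isCountable hcof hcn hS hfin hne T R ρ' baseAct h37 hG hV hBR) w₀ (D.isCompact_piPresentation_H h37.toProp36Hypotheses.isCountable T R w₀) (fun n => (D.projAut h37.toProp36Hypotheses.isCountable n).ker) (fun _ => MonoidHom.normal_ker _) (D.hKst_and_hLst_of_ker_piLevelAut_eq_charOpenCore h37.toProp36Hypotheses.isCountable hconn T R ρ' (isArithCompatible_piPresentation_outerAction_of_branchPair_chart_of_finite D h37.toProp36Hypotheses.isCountable hcof hcn hS hfin hne T R ρ' baseAct h37 hG hV hBR) d hker).1 (D.ker_projAut_anti h37.toProp36Hypotheses.isCountable) (D.isOpen_ker_projAut h37.toProp36Hypotheses.isCountable) (fun _ hU => D.exists_ker_projAut_subset h37.toProp36Hypotheses.isCountable hU) hK1'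
  haveI := arithLevelTopology_t2Space (D.chart h37.toProp36Hypotheses.isCountable hcof hcn hS hfin hne) ρ' baseAct h37.toProp36Hypotheses IsTempered.of_profinite (D.piPresentation h37.toProp36Hypotheses.isCountable T R) (isArithCompatible_piPresentation_outerAction_of_branchPair_chart_of_finite D h37.toProp36Hypotheses.isCountable hcof hcn hS hfin hne T R ρ' baseAct h37 hG hV hBR) w₀ (D.isCompact_piPresentation_H h37.toProp36Hypotheses.isCountable T R w₀) (fun n => (D.projAut h37.toProp36Hypotheses.isCountable n).ker) (fun _ => MonoidHom.normal_ker _) (D.hKst_and_hLst_of_ker_piLevelAut_eq_charOpenCore h37.toProp36Hypotheses.isCountable hconn T R ρ' (isArithCompatible_piPresentation_outerAction_of_branchPair_chart_of_finite D h37.toProp36Hypotheses.isCountable hcof hcn hS hfin hne T R ρ' baseAct h37 hG hV hBR) d hker).1 (D.ker_projAut_anti h37.toProp36Hypotheses.isCountable) (D.isOpen_ker_projAut h37.toProp36Hypotheses.isCountable) (fun _ hU => D.exists_ker_projAut_subset h37.toProp36Hypotheses.isCountable hU) hK1'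
  -- `Π_A` profinite ⇒ Hausdorff (points of a totally disconnected space are closed)
  haveI : T2Space PA := by
    rw [IsTopologicalGroup.t2Space_iff_one_closed,
      ← totallyDisconnectedSpace_iff_connectedComponent_singleton.mp inferInstance (1 : PA)]
    exact isClosed_connectedComponent
  -- `haugc`, `hLopen` at the finite levels (abc-iut-w6-d070)
  have haugc := continuous_outerSemidirectProductSnd (D.chart h37.toProp36Hypotheses.isCountable hcof hcn hS hfin hne) ρ' baseAct h37.toProp36Hypotheses IsTempered.of_profinite (D.piPresentation h37.toProp36Hypotheses.isCountable T R) (isArithCompatible_piPresentation_outerAction_of_branchPair_chart_of_finite D h37.toProp36Hypotheses.isCountable hcof hcn hS hfin hne T R ρ' baseAct h37 hG hV hBR) w₀ (D.isCompact_piPresentation_H h37.toProp36Hypotheses.isCountable T R w₀) (fun n => (D.projAut h37.toProp36Hypotheses.isCountable n).ker) (fun _ => MonoidHom.normal_ker _) (D.hKst_and_hLst_of_ker_piLevelAut_eq_charOpenCore h37.toProp36Hypotheses.isCountable hconn T R ρ' (isArithCompatible_piPresentation_outerAction_of_branchPair_chart_of_finite D h37.toProp36Hypotheses.isCountable hcof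 hcn hS hfin hne T R ρ' baseAct h37 hG hV hBR) d hker).1 (D.ker_projAut_anti h37.toProp36Hypotheses.isCountable) (D.isOpen_ker_projAut h37.toProp36Hypotheses.isCountable) (fun _ hU => D.exists_ker_projAut_subset h37.toProp36Hypotheses.isCountable hU) hK1'
  have hLopen : ∀ n, IsOpen (((D.piPresentation h37.toProp36Hypotheses.isCountable T R).arithAct (isArithCompatible_piPresentation_outerAction_of_branchPair_chart_of_finite D h37.toProp36Hypotheses.isCountable hcof hcn hS hfin hne T R ρ' baseAct h37 hG hV hBR) (D.piLevelAut h37.toProp36Hypotheses.isCountable hconn n).ker ((D.hKst_and_hLst_of_ker_piLevelAut_eq_charOpenCore h37.toProp36Hypotheses.isCountable hconn T R ρ' (isArithCompatible_piPresentation_outerAction_of_branchPair_chart_of_finite D h37.toProp36Hypotheses.isCountable hcof hcn hS hfin hne T R ρ' baseAct h37 hG hV hBR) d hker).2 n)).ker :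
      Set (outerSemidirectProduct ρ')) := fun n =>
    isOpen_ker_arithAct_of_le (D.chart h37.toProp36Hypotheses.isCountable hcof hcn hS hfin hne) ρ' baseAct h37.toProp36Hypotheses IsTempered.of_profinite (D.piPresentation h37.toProp36Hypotheses.isCountable T R) (isArithCompatible_piPresentation_outerAction_of_branchPair_chart_of_finite D h37.toProp36Hypotheses.isCountable hcof hcn hS hfin hne T R ρ' baseAct h37 hG hV hBR) w₀ (D.isCompact_piPresentation_H h37.toProp36Hypotheses.isCountable T R w₀) (fun n => (D.projAut h37.toProp36Hypotheses.isCountable n).ker) (fun _ => MonoidHom.normal_ker _) (D.hKst_and_hLst_of_ker_piLevelAut_eq_charOpenCore h37.toProp36Hypotheses.isCountable hconn T R ρ' (isArithCompatible_piPresentation_outerAction_of_branchPair_chart_of_finite D h37.toProp36Hypotheses.isCountable hcof hcn hS hfin hne T R ρ' baseAct h37 hG hV hBR) d hker).1 (D.ker_projAut_anti h37.toProp36Hypotheses.isCountable) (D.isOpen_ker_projAut h37.toProp36Hypotheses.isCountable) (fun _ hU => D.exists_ker_projAut_subset h37.toProp36Hypotheses.isCountable hU) hK1' ((D.hKst_and_hLst_of_ker_piLevelAut_eq_charOpenCore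 h37.toProp36Hypotheses.isCountable hconn T R ρ' (isArithCompatible_piPresentation_outerAction_of_branchPair_chart_of_finite D h37.toProp36Hypotheses.isCountable hcof hcn hS hfin hne T R ρ' baseAct h37 hG hV hBR) d hker).2 n) (D.ker_projAut_le_ker_piLevelAut h37.toProp36Hypotheses.isCountable hconn n)
  -- `hVc` package-free (abc-iut-w4-d059 `hVc_of_cosetTower`, [SemiAnbd] Rmk 5.3.1)
  have hVc : ∀ v, IsCompact (((decompositionDataOfChart Rc (toOuterSemidirectProduct ρ')).vertGp v :
      Subgroup (outerSemidirectProduct ρ')) : Set (outerSemidirectProduct ρ')) :=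
    hVc_of_cosetTower (D.chart h37.toProp36Hypotheses.isCountable hcof hcn hS hfin hne) (D.piPresentation h37.toProp36Hypotheses.isCountable T R) (isArithCompatible_piPresentation_outerAction_of_branchPair_chart_of_finite D h37.toProp36Hypotheses.isCountable hcof hcn hS hfin hne T R ρ' baseAct h37 hG hV hBR) (toOuterSemidirectProduct ρ') hι (fun e x => conj_toOuterSemidirectProduct ρ' e x)
      hιΦ hισ hPH Rc hRcV (fun n => (D.projAut h37.toProp36Hypotheses.isCountable n).ker) (D.hKst_and_hLst_of_ker_piLevelAut_eq_charOpenCore h37.toProp36Hypotheses.isCountable hconn T R ρ' (isArithCompatible_piPresentation_outerAction_of_branchPair_chart_of_finite D h37.toProp36Hypotheses.isCountable hcof hcn hS hfin hne T R ρ' baseAct h37 hG hV hBR) d hker).1 (D.piPresentation_hHK h37.toProp36Hypotheses.isCountable T R) h37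
      (fun n => isOpen_ker_arithAct (D.chart h37.toProp36Hypotheses.isCountable hcof hcn hS hfin hne) ρ' baseAct h37.toProp36Hypotheses IsTempered.of_profinite (D.piPresentation h37.toProp36Hypotheses.isCountable T R) (isArithCompatible_piPresentation_outerAction_of_branchPair_chart_of_finite D h37.toProp36Hypotheses.isCountable hcof hcn hS hfin hne T R ρ' baseAct h37 hG hV hBR) w₀ (D.isCompact_piPresentation_H h37.toProp36Hypotheses.isCountable T R w₀) (fun n => (D.projAut h37.toProp36Hypotheses.isCountable n).ker) (fun _ => MonoidHom.normal_ker _) (D.hKst_and_hLst_of_ker_piLevelAut_eq_charOpenCore h37.toProp36Hypotheses.isCountable hconn T R ρ' (isArithCompatible_piPresentation_outerAction_of_branchPair_chart_of_finite D h37.toProp36Hypotheses.isCountable hcof hcn hS hfin hne T R ρ' baseAct h37 hG hV hBR) d hker).1 (D.ker_projAut_anti h37.toProp36Hypotheses.isCountable) (D.isOpen_ker_projAut h37.toProp36Hypotheses.isCountable) (fun _ hU => D.exists_ker_projAut_subset h37.toProp36Hypotheses.isCountable hU) hK1' n) (isTempered_arithLevelTopology (D.chart h37.toProp36Hypotheses.isCountable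 hcof hcn hS hfin hne) ρ' baseAct h37.toProp36Hypotheses IsTempered.of_profinite (D.piPresentation h37.toProp36Hypotheses.isCountable T R) (isArithCompatible_piPresentation_outerAction_of_branchPair_chart_of_finite D h37.toProp36Hypotheses.isCountable hcof hcn hS hfin hne T R ρ' baseAct h37 hG hV hBR) w₀ (D.isCompact_piPresentation_H h37.toProp36Hypotheses.isCountable T R w₀) (fun n => (D.projAut h37.toProp36Hypotheses.isCountable n).ker) (fun _ => MonoidHom.normal_ker _) (D.hKst_and_hLst_of_ker_piLevelAut_eq_charOpenCore h37.toProp36Hypotheses.isCountable hconn T R ρ' (isArithCompatible_piPresentation_outerAction_of_branchPair_chart_of_finite D h37.toProp36Hypotheses.isCountable hcof hcn hS hfin hne T R ρ' baseAct h37 hG hV hBR) d hker).1 (D.ker_projAut_anti h37.toProp36Hypotheses.isCountable) (D.isOpen_ker_projAut h37.toProp36Hypotheses.isCountable) (fun _ hU => D.exists_ker_projAut_subset h37.toProp36Hypotheses.isCountable hU) hK1')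
      (outerSemidirectProductSnd ρ') (arithLevelTopology_nhds_hasBasis (D.chart h37.toProp36Hypotheses.isCountable hcof hcn hS hfin hne) ρ' baseAct h37.toProp36Hypotheses IsTempered.of_profinite (D.piPresentation h37.toProp36Hypotheses.isCountable T R) (isArithCompatible_piPresentation_outerAction_of_branchPair_chart_of_finite D h37.toProp36Hypotheses.isCountable hcof hcn hS hfin hne T R ρ' baseAct h37 hG hV hBR) w₀ (D.isCompact_piPresentation_H h37.toProp36Hypotheses.isCountable T R w₀) (fun n => (D.projAut h37.toProp36Hypotheses.isCountable n).ker) (fun _ => MonoidHom.normal_ker _) (D.hKst_and_hLst_of_ker_piLevelAut_eq_charOpenCore h37.toProp36Hypotheses.isCountable hconn T R ρ' (isArithCompatible_piPresentation_outerAction_of_branchPair_chart_of_finite D h37.toProp36Hypotheses.isCountable hcof hcn hS hfin hne T R ρ' baseAct h37 hG hV hBR) d hker).1 (D.ker_projAut_anti h37.toProp36Hypotheses.isCountable) (D.isOpen_ker_projAut h37.toProp36Hypotheses.isCountable) (fun _ hU => D.exists_ker_projAut_subset h37.toProp36Hypotheses.isCountable hU) hK1') hex.symm.le hK1'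
      (D.isOpen_ker_projAut h37.toProp36Hypotheses.isCountable)
  -- `hUclosed` (abc-iut-w4-d085)
  have hUclosed : ∀ n : ℕ, IsClosed ((((((D.piPresentation h37.toProp36Hypotheses.isCountable T R).arithAct (isArithCompatible_piPresentation_outerAction_of_branchPair_chart_of_finite D h37.toProp36Hypotheses.isCountable hcof hcn hS hfin hne T R ρ' baseAct h37 hG hV hBR) (D.piLevelAut h37.toProp36Hypotheses.isCountable hconn n).ker
      ((D.hKst_and_hLst_of_ker_piLevelAut_eq_charOpenCore h37.toProp36Hypotheses.isCountable hconn T R ρ' (isArithCompatible_piPresentation_outerAction_of_branchPair_chart_of_finite D h37.toProp36Hypotheses.isCountable hcof hcn hS hfin hne T R ρ' baseAct h37 hG hV hBR) d hker).2 n)).ker).map (outerSemidirectProductSnd ρ') : Subgroup PA) : Set PA)) := fun n =>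
    isClosed_map_ker_arithAct_arithLevelTopology (D.chart h37.toProp36Hypotheses.isCountable hcof hcn hS hfin hne) ρ' baseAct (D.piPresentation h37.toProp36Hypotheses.isCountable T R) (isArithCompatible_piPresentation_outerAction_of_branchPair_chart_of_finite D h37.toProp36Hypotheses.isCountable hcof hcn hS hfin hne T R ρ' baseAct h37 hG hV hBR) h37.toProp36Hypotheses
      IsTempered.of_profinite w₀ (D.isCompact_piPresentation_H h37.toProp36Hypotheses.isCountable T R w₀) (fun n => (D.projAut h37.toProp36Hypotheses.isCountable n).ker)
      (fun _ => MonoidHom.normal_ker _) (D.hKst_and_hLst_of_ker_piLevelAut_eq_charOpenCore h37.toProp36Hypotheses.isCountable hconn T R ρ' (isArithCompatible_piPresentation_outerAction_of_branchPair_chart_of_finite D h37.toProp36Hypotheses.isCountable hcof hcn hS hfin hne T R ρ' baseAct h37 hG hV hBR) d hker).1 (D.ker_projAut_anti h37.toProp36Hypotheses.isCountable) (D.isOpen_ker_projAut h37.toProp36Hypotheses.isCountable)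
      (fun _ hU => D.exists_ker_projAut_subset h37.toProp36Hypotheses.isCountable hU) hK1' ((D.hKst_and_hLst_of_ker_piLevelAut_eq_charOpenCore h37.toProp36Hypotheses.isCountable hconn T R ρ' (isArithCompatible_piPresentation_outerAction_of_branchPair_chart_of_finite D h37.toProp36Hypotheses.isCountable hcof hcn hS hfin hne T R ρ' baseAct h37 hG hV hBR) d hker).2 n) (D.ker_projAut_le_ker_piLevelAut h37.toProp36Hypotheses.isCountable hconn n)
  -- `hU` is a THEOREM of the tower data (abc-iut-w4-d085 `hU_arithVertGp_outerAction`, p442216)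
  have hU : ∀ (v₀ : 𝒢.graph.Vertex) (a : PA), (∀ n : ℕ, a ∈ (((D.piPresentation h37.toProp36Hypotheses.isCountable T R).arithAct (isArithCompatible_piPresentation_outerAction_of_branchPair_chart_of_finite D h37.toProp36Hypotheses.isCountable hcof hcn hS hfin hne T R ρ' baseAct h37 hG hV hBR)
        (D.piLevelAut h37.toProp36Hypotheses.isCountable hconn n).ker ((D.hKst_and_hLst_of_ker_piLevelAut_eq_charOpenCore h37.toProp36Hypotheses.isCountable hconn T R ρ' (isArithCompatible_piPresentation_outerAction_of_branchPair_chart_of_finite D h37.toProp36Hypotheses.isCountable hcof hcn hS hfin hne T R ρ' baseAct h37 hG hV hBR) d hker).2 n)).ker).map (outerSemidirectProductSnd ρ')) →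
      ∃ z ∈ (decompositionDataOfChart Rc (toOuterSemidirectProduct ρ')).vertGp v₀, outerSemidirectProductSnd ρ' z = a ∧
        ∀ n : ℕ, (D.piPresentation h37.toProp36Hypotheses.isCountable T R).arithAct (isArithCompatible_piPresentation_outerAction_of_branchPair_chart_of_finite D h37.toProp36Hypotheses.isCountable hcof hcn hS hfin hne T R ρ' baseAct h37 hG hV hBR) (D.piLevelAut h37.toProp36Hypotheses.isCountable hconn n).ker ((D.hKst_and_hLst_of_ker_piLevelAut_eq_charOpenCore h37.toProp36Hypotheses.isCountable hconn T R ρ' (isArithCompatible_piPresentation_outerAction_of_branchPair_chart_of_finite D h37.toProp36Hypotheses.isCountable hcof hcn hS hfin hne T R ρ' baseAct h37 hG hV hBR) d hker).2 n) z = 1 := fun v₀ a ha =>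
    hU_arithVertGp_outerAction (D.chart h37.toProp36Hypotheses.isCountable hcof hcn hS hfin hne) ρ' baseAct (D.piPresentation h37.toProp36Hypotheses.isCountable T R) (isArithCompatible_piPresentation_outerAction_of_branchPair_chart_of_finite D h37.toProp36Hypotheses.isCountable hcof hcn hS hfin hne T R ρ' baseAct h37 hG hV hBR) hex
      (fun n => (D.projAut h37.toProp36Hypotheses.isCountable n).ker) (D.ker_projAut_anti h37.toProp36Hypotheses.isCountable) (D.hKst_and_hLst_of_ker_piLevelAut_eq_charOpenCore h37.toProp36Hypotheses.isCountable hconn T R ρ' (isArithCompatible_piPresentation_outerAction_of_branchPair_chart_of_finite D h37.toProp36Hypotheses.isCountable hcof hcn hS hfin hne T R ρ' baseAct h37 hG hV hBR) d hker).1 (D.piPresentation_hHK h37.toProp36Hypotheses.isCountable T R)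
      (D.piPresentation_hlift h37.toProp36Hypotheses.isCountable T R) (fun n => (D.piLevelAut h37.toProp36Hypotheses.isCountable hconn n).ker) (D.hKst_and_hLst_of_ker_piLevelAut_eq_charOpenCore h37.toProp36Hypotheses.isCountable hconn T R ρ' (isArithCompatible_piPresentation_outerAction_of_branchPair_chart_of_finite D h37.toProp36Hypotheses.isCountable hcof hcn hS hfin hne T R ρ' baseAct h37 hG hV hBR) d hker).2
      (fun n => D.ker_projAut_le_ker_piLevelAut h37.toProp36Hypotheses.isCountable hconn n) (fun n => D.isOpen_ker_piLevelAut h37.toProp36Hypotheses.isCountable hconn n)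
      (D.ker_piLevelAut_anti h37.toProp36Hypotheses.isCountable hconn) v₀ (hHc v₀) Rc hRcV ha
  -- `hnobpNCpt` (abc-iut-w4-d053's chart transport of abc-iut-w4-d083's producer, mod (I0v))
  have hnobpNCpt := hnobpNCpt_cosetTower_of_faithV_chart D h37.toProp36Hypotheses.isCountable hcof hcn hS hfin hne hconn T R h37 (isArithCompatible_piPresentation_outerAction_of_branchPair_chart_of_finite D h37.toProp36Hypotheses.isCountable hcof hcn hS hfin hne T R ρ' baseAct h37 hG hV hBR) (D.hKst_and_hLst_of_ker_piLevelAut_eq_charOpenCore h37.toProp36Hypotheses.isCountable hconn T R ρ' (isArithCompatible_piPresentation_outerAction_of_branchPair_chart_of_finite D h37.toProp36Hypotheses.isCountable hcof hcn hS hfin hne T R ρ' baseAct h37 hG hV hBR) d hker).2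
    (toOuterSemidirectProduct ρ') hιΦ hισ hfaithV
  -- (AI4″) `stabBranchPairAug` PRODUCED (abc-iut-w4-d059 p442253, hcof-free form over abc-iut-w4-d085)
  have stabBranchPairAug := stabBranchPairAug_chart_outerAction_modKernel D h37.toProp36Hypotheses.isCountable hcof hcn hS hfin hne hconn h37 T R
    ρ' baseAct (isArithCompatible_piPresentation_outerAction_of_branchPair_chart_of_finite D h37.toProp36Hypotheses.isCountable hcof hcn hS hfin hne T R ρ' baseAct h37 hG hV hBR) (D.hKst_and_hLst_of_ker_piLevelAut_eq_charOpenCore h37.toProp36Hypotheses.isCountable hconn T R ρ' (isArithCompatible_piPresentation_outerAction_of_branchPair_chart_of_finite D h37.toProp36Hypotheses.isCountable hcof hcn hS hfin hne T R ρ' baseAct h37 hG hV hBR) d hker).2 haugc Rc hRcV hRcB hLopen hVc hUclosed hU hnobpNCpt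
  exact arithMaximalCompactStatement_outerAction_piPresentation_chart_of_producers_levelTopology D h37.toProp36Hypotheses.isCountable hcof hcn hS hfin hne hconn
    h37 hG ρ' baseAct T R Rc hV hE hopen hBR w₀ d hker hfaithV hK1' rfl noSwitchBase stabBranchPairAug hest hbot

end Chart

/-! ### The characteristic tower: CAPSTONE v6 -/

/-- **[SemiAnbd] Thm 5.4 (i) ∧ (ii) at `π₁^temp(𝒢) ⋊^out Π_A` for the chart of the CHARACTERISTIC Galois tower —
CAPSTONE v6**: v5 (`…_charCores_of_designData_hCC` p444735) with the design inputs `hE` (edge transport) and `hopen`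
(Def 5.1 (i)(c)) DERIVED from `hBR` resp. `hCC`.  HONEST RESIDUAL (explicit binders): vertex transport `hV` and branch
transport `hBR` (Prop 3.6 (iv) at `ρ_𝔾(a)` / Def 5.1 (i); abc-iut-w4-d082's currency), `hRcV`/`hRcB` (the §3
representatives are those read off the presentation), `n₁`/`hCC` (Def 5.1 (i)(c)/(d) congruence-continuity at the
deep tree levels — DESIGN), `hinst` (`rfl` at consumers), Thm 5.4's printed frame `noSwitchBase` and OWN hypotheses
`hest`/`hbot`, the §5 frame and Def 5.1 (i) coherence, `v₀`, `h37`, `hG`.  GONE relative to v5: `hE`, `hopen`.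
Nothing beyond composition (and the two derivations) is proved here. [cite: MochizukiSemiAnbd2006, Thm 5.4 (i), p. 66] -/
theorem arithMaximalCompactStatement_outerAction_piPresentation_charCores_of_designData_hCC_v6
    (h37 : 𝒢.Thm37Hypotheses) (hG : 𝒢.graph.IsGraph) [Finite 𝒢.graph.Vertex] [Finite 𝒢.graph.Branch]
    [Finite 𝒢.graph.Edge] (v₀ : 𝒢.graph.Vertex)
    -- coherence (Def 5.1 (i)): topologically finitely generated constituents — the input of the characteristic tower
    (hVt : ∀ v : 𝒢.graph.Vertex, IsTopologicallyFinitelyGenerated (𝒢.Gv v))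
    (hEt : ∀ e : 𝒢.graph.Edge, IsTopologicallyFinitelyGenerated (𝒢.Ge e))
    {PA : Type u} [Group PA] [TopologicalSpace PA] [IsTopologicalGroup PA] [CompactSpace PA]
    [TotallyDisconnectedSpace PA]
    (ρ' : PA →* TopOut ((GaloisLevelData.ofCharCores h37.toProp36Hypotheses v₀ hVt hEt).chart h37.toProp36Hypotheses.isCountable (ofCharCores_exists_level_splits_component h37.toProp36Hypotheses v₀ hVt hEt) h37.toProp36Hypotheses.isConnected (ofCharCores_splits_self h37.toProp36Hypotheses v₀ hVt hEt) (ofCharCores_isFinite h37.toProp36Hypotheses v₀ hVt hEt) (ofCharCores_hasNonemptyFibres h37.toProp36Hypotheses v₀ hVt hEt)).G) (baseAct : PA →* Aut 𝒢.graph)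
    [inst : TopologicalSpace (outerSemidirectProduct ρ')]
    (T : ∀ w : 𝒢.graph.Vertex, (GaloisLevelData.ofCharCores h37.toProp36Hypotheses v₀ hVt hEt).PointSeq h37.toProp36Hypotheses.isCountable w) (R : SemiGraph.RefBranches 𝒢.graph)
    -- §3 representatives MATCHED to the presentation (abc-iut-w4-d059's `hRcV`/`hRcB`)
    (Rc : ChartRepresentatives ((GaloisLevelData.ofCharCores h37.toProp36Hypotheses v₀ hVt hEt).chart h37.toProp36Hypotheses.isCountable (ofCharCores_exists_level_splits_component h37.toProp36Hypotheses v₀ hVt hEt) h37.toProp36Hypotheses.isConnected (ofCharCores_splits_self h37.toProp36Hypotheses v₀ hVt hEt) (ofCharCores_isFinite h37.toProp36Hypotheses v₀ hVt hEt) (ofCharCores_hasNonemptyFibres h37.toProp36Hypotheses v₀ hVt hEt)))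
    (hRcV : ∀ v, Rc.Hv v = ((GaloisLevelData.ofCharCores h37.toProp36Hypotheses v₀ hVt hEt).piPresentation h37.toProp36Hypotheses.isCountable T R).H v)
    (hRcB : ∀ b, Rc.Hb b = (((GaloisLevelData.ofCharCores h37.toProp36Hypotheses v₀ hVt hEt).piPresentation h37.toProp36Hypotheses.isCountable T R).M (𝒢.graph.edgeOf b)).map
      (MulAut.conj (((GaloisLevelData.ofCharCores h37.toProp36Hypotheses v₀ hVt hEt).piPresentation h37.toProp36Hypotheses.isCountable T R).s b)).toMonoidHom)
    -- Prop 3.6 (iv) at `ρ_𝔾(a)` / Def 5.1 (i): the DESIGN data of the outer model (abc-iut-w4-d082's currency) — vertex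
    -- transport `hV` and branch transport `hBR` (edge transport `hE` and `hopen` are DERIVED inside)
    (hV : ∀ (a : PA) (v : 𝒢.graph.Vertex) (H : Subgroup ((GaloisLevelData.ofCharCores h37.toProp36Hypotheses v₀ hVt hEt).chart h37.toProp36Hypotheses.isCountable (ofCharCores_exists_level_splits_component h37.toProp36Hypotheses v₀ hVt hEt) h37.toProp36Hypotheses.isConnected (ofCharCores_splits_self h37.toProp36Hypotheses v₀ hVt hEt) (ofCharCores_isFinite h37.toProp36Hypotheses v₀ hVt hEt) (ofCharCores_hasNonemptyFibres h37.toProp36Hypotheses v₀ hVt hEt)).G), H ∈ verticialSubgroups ((GaloisLevelData.ofCharCores h37.toProp36Hypotheses v₀ hVt hEt).chart h37.toProp36Hypotheses.isCountable (ofCharCores_exists_level_splits_component h37.toProp36Hypotheses v₀ hVt hEt) h37.toProp36Hypotheses.isConnected (ofCharCores_splits_self h37.toProp36Hypotheses v₀ hVt hEt) (ofCharCores_isFinite h37.toProp36Hypotheses v₀ hVt hEt) (ofCharCores_hasNonemptyFibres h37.toProp36Hypotheses v₀ hVt hEt)) v →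
      ∃ φ : contMulAut ((GaloisLevelData.ofCharCores h37.toProp36Hypotheses v₀ hVt hEt).chart h37.toProp36Hypotheses.isCountable (ofCharCores_exists_level_splits_component h37.toProp36Hypotheses v₀ hVt hEt) h37.toProp36Hypotheses.isConnected (ofCharCores_splits_self h37.toProp36Hypotheses v₀ hVt hEt) (ofCharCores_isFinite h37.toProp36Hypotheses v₀ hVt hEt) (ofCharCores_hasNonemptyFibres h37.toProp36Hypotheses v₀ hVt hEt)).G, TopOut.mk _ φ = ρ' a ∧
        H.map (φ : MulAut ((GaloisLevelData.ofCharCores h37.toProp36Hypotheses v₀ hVt hEt).chart h37.toProp36Hypotheses.isCountable (ofCharCores_exists_level_splits_component h37.toProp36Hypotheses v₀ hVt hEt) h37.toProp36Hypotheses.isConnected (ofCharCores_splits_self h37.toProp36Hypotheses v₀ hVt hEt) (ofCharCores_isFinite h37.toProp36Hypotheses v₀ hVt hEt) (ofCharCores_hasNonemptyFibres h37.toProp36Hypotheses v₀ hVt hEt)).G).toMonoidHom ∈ verticialSubgroups ((GaloisLevelData.ofCharCores h37.toProp36Hypotheses v₀ hVt hEt).chart h37.toProp36Hypotheses.isCountable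 (ofCharCores_exists_level_splits_component h37.toProp36Hypotheses v₀ hVt hEt) h37.toProp36Hypotheses.isConnected (ofCharCores_splits_self h37.toProp36Hypotheses v₀ hVt hEt) (ofCharCores_isFinite h37.toProp36Hypotheses v₀ hVt hEt) (ofCharCores_hasNonemptyFibres h37.toProp36Hypotheses v₀ hVt hEt)) ((baseAct a).hom.vertexMap v))
    (hBR : ∀ (a : PA) (b : 𝒢.graph.Branch) (v : 𝒢.graph.Vertex) (hb : 𝒢.graph.abuts b = some v)
      (φ : 𝒢.Gv v →ₜ* ((GaloisLevelData.ofCharCores h37.toProp36Hypotheses v₀ hVt hEt).chart h37.toProp36Hypotheses.isCountable (ofCharCores_exists_level_splits_component h37.toProp36Hypotheses v₀ hVt hEt) h37.toProp36Hypotheses.isConnected (ofCharCores_splits_self h37.toProp36Hypotheses v₀ hVt hEt) (ofCharCores_isFinite h37.toProp36Hypotheses v₀ hVt hEt) (ofCharCores_hasNonemptyFibres h37.toProp36Hypotheses v₀ hVt hEt)).G), IsVerticialHom ((GaloisLevelData.ofCharCores h37.toProp36Hypotheses v₀ hVt hEt).chart h37.toProp36Hypotheses.isCountable (ofCharCores_exists_level_splits_component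 h37.toProp36Hypotheses v₀ hVt hEt) h37.toProp36Hypotheses.isConnected (ofCharCores_splits_self h37.toProp36Hypotheses v₀ hVt hEt) (ofCharCores_isFinite h37.toProp36Hypotheses v₀ hVt hEt) (ofCharCores_hasNonemptyFibres h37.toProp36Hypotheses v₀ hVt hEt)) v φ →
      ∃ Φ : contMulAut ((GaloisLevelData.ofCharCores h37.toProp36Hypotheses v₀ hVt hEt).chart h37.toProp36Hypotheses.isCountable (ofCharCores_exists_level_splits_component h37.toProp36Hypotheses v₀ hVt hEt) h37.toProp36Hypotheses.isConnected (ofCharCores_splits_self h37.toProp36Hypotheses v₀ hVt hEt) (ofCharCores_isFinite h37.toProp36Hypotheses v₀ hVt hEt) (ofCharCores_hasNonemptyFibres h37.toProp36Hypotheses v₀ hVt hEt)).G, TopOut.mk _ Φ = ρ' a ∧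
        ∃ φ' : 𝒢.Gv ((baseAct a).hom.vertexMap v) →ₜ* ((GaloisLevelData.ofCharCores h37.toProp36Hypotheses v₀ hVt hEt).chart h37.toProp36Hypotheses.isCountable (ofCharCores_exists_level_splits_component h37.toProp36Hypotheses v₀ hVt hEt) h37.toProp36Hypotheses.isConnected (ofCharCores_splits_self h37.toProp36Hypotheses v₀ hVt hEt) (ofCharCores_isFinite h37.toProp36Hypotheses v₀ hVt hEt) (ofCharCores_hasNonemptyFibres h37.toProp36Hypotheses v₀ hVt hEt)).G,
          IsVerticialHom ((GaloisLevelData.ofCharCores h37.toProp36Hypotheses v₀ hVt hEt).chart h37.toProp36Hypotheses.isCountable (ofCharCores_exists_level_splits_component h37.toProp36Hypotheses v₀ hVt hEt) h37.toProp36Hypotheses.isConnected (ofCharCores_splits_self h37.toProp36Hypotheses v₀ hVt hEt) (ofCharCores_isFinite h37.toProp36Hypotheses v₀ hVt hEt) (ofCharCores_hasNonemptyFibres h37.toProp36Hypotheses v₀ hVt hEt)) ((baseAct a).hom.vertexMap v) φ' ∧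
          ∃ x' : ((GaloisLevelData.ofCharCores h37.toProp36Hypotheses v₀ hVt hEt).chart h37.toProp36Hypotheses.isCountable (ofCharCores_exists_level_splits_component h37.toProp36Hypotheses v₀ hVt hEt) h37.toProp36Hypotheses.isConnected (ofCharCores_splits_self h37.toProp36Hypotheses v₀ hVt hEt) (ofCharCores_isFinite h37.toProp36Hypotheses v₀ hVt hEt) (ofCharCores_hasNonemptyFibres h37.toProp36Hypotheses v₀ hVt hEt)).G,
            Subgroup.map (Φ : MulAut ((GaloisLevelData.ofCharCores h37.toProp36Hypotheses v₀ hVt hEt).chart h37.toProp36Hypotheses.isCountable (ofCharCores_exists_level_splits_component h37.toProp36Hypotheses v₀ hVt hEt) h37.toProp36Hypotheses.isConnected (ofCharCores_splits_self h37.toProp36Hypotheses v₀ hVt hEt) (ofCharCores_isFinite h37.toProp36Hypotheses v₀ hVt hEt) (ofCharCores_hasNonemptyFibres h37.toProp36Hypotheses v₀ hVt hEt)).G).toMonoidHom φ.toMonoidHom.range =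
              Subgroup.map (MulAut.conj x').toMonoidHom φ'.toMonoidHom.range ∧
            Subgroup.map (Φ : MulAut ((GaloisLevelData.ofCharCores h37.toProp36Hypotheses v₀ hVt hEt).chart h37.toProp36Hypotheses.isCountable (ofCharCores_exists_level_splits_component h37.toProp36Hypotheses v₀ hVt hEt) h37.toProp36Hypotheses.isConnected (ofCharCores_splits_self h37.toProp36Hypotheses v₀ hVt hEt) (ofCharCores_isFinite h37.toProp36Hypotheses v₀ hVt hEt) (ofCharCores_hasNonemptyFibres h37.toProp36Hypotheses v₀ hVt hEt)).G).toMonoidHom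
                (Subgroup.map φ.toMonoidHom (𝒢.branchSubgroup b v hb)) =
              Subgroup.map (MulAut.conj x').toMonoidHom
                (Subgroup.map φ'.toMonoidHom
                  (𝒢.branchSubgroup ((baseAct a).hom.branchMap b) ((baseAct a).hom.vertexMap v)
                    ((baseAct a).hom.abuts_branchMap b v hb))))
    (w₀ : 𝒢.graph.Vertex)
    -- the continuity binder `hK1′` REDUCED (abc-iut-w6-d117 p442489 / abc-iut-w4-d089 p440870): beyond depth `n₁` the
    -- outer action is CONGRUENCE-CONTINUOUS with trivial base action near `1` (`hCC`, Def 5.1 (i)(c)/(d) — DESIGN);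
    -- `hself` is abc-iut-w6-d117's THEOREM `exists_forall_piPresentation_hself_chart` (no binder)
    (n₁ : ℕ)
    (hCC : ∀ n, n₁ ≤ n → ∃ U ∈ 𝓝 (1 : PA), ∀ a ∈ U, baseAct a = 1 ∧
      ∃ φ : contMulAut ((GaloisLevelData.ofCharCores h37.toProp36Hypotheses v₀ hVt hEt).chart h37.toProp36Hypotheses.isCountable (ofCharCores_exists_level_splits_component h37.toProp36Hypotheses v₀ hVt hEt) h37.toProp36Hypotheses.isConnected (ofCharCores_splits_self h37.toProp36Hypotheses v₀ hVt hEt) (ofCharCores_isFinite h37.toProp36Hypotheses v₀ hVt hEt) (ofCharCores_hasNonemptyFibres h37.toProp36Hypotheses v₀ hVt hEt)).G, TopOut.mk ((GaloisLevelData.ofCharCores h37.toProp36Hypotheses v₀ hVt hEt).chart h37.toProp36Hypotheses.isCountable (ofCharCores_exists_level_splits_component h37.toProp36Hypotheses v₀ hVt hEt) h37.toProp36Hypotheses.isConnected (ofCharCores_splits_self h37.toProp36Hypotheses v₀ hVt hEt) (ofCharCores_isFinite h37.toProp36Hypotheses v₀ hVt hEt) (ofCharCores_hasNonemptyFibres h37.toProp36Hypotheses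 v₀ hVt hEt)).G φ = ρ' a ∧
        ∀ y : ((GaloisLevelData.ofCharCores h37.toProp36Hypotheses v₀ hVt hEt).chart h37.toProp36Hypotheses.isCountable (ofCharCores_exists_level_splits_component h37.toProp36Hypotheses v₀ hVt hEt) h37.toProp36Hypotheses.isConnected (ofCharCores_splits_self h37.toProp36Hypotheses v₀ hVt hEt) (ofCharCores_isFinite h37.toProp36Hypotheses v₀ hVt hEt) (ofCharCores_hasNonemptyFibres h37.toProp36Hypotheses v₀ hVt hEt)).G, (φ : MulAut ((GaloisLevelData.ofCharCores h37.toProp36Hypotheses v₀ hVt hEt).chart h37.toProp36Hypotheses.isCountable (ofCharCores_exists_level_splits_component h37.toProp36Hypotheses v₀ hVt hEt) h37.toProp36Hypotheses.isConnected (ofCharCores_splits_self h37.toProp36Hypotheses v₀ hVt hEt) (ofCharCores_isFinite h37.toProp36Hypotheses v₀ hVt hEt) (ofCharCores_hasNonemptyFibres h37.toProp36Hypotheses v₀ hVt hEt)).G) y * y⁻¹ ∈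
          ((GaloisLevelData.ofCharCores h37.toProp36Hypotheses v₀ hVt hEt).projAut h37.toProp36Hypotheses.isCountable n).ker)
    -- the topology of `E` IS abc-iut-w6-d070's tempered level topology at the chart of the tower (`hK1′` := the
    -- term derived from `hCC`, abc-iut-w6-d117 p442489)
    (hinst : inst = @arithLevelTopology 𝒢 ((GaloisLevelData.ofCharCores h37.toProp36Hypotheses v₀ hVt hEt).chart h37.toProp36Hypotheses.isCountable (ofCharCores_exists_level_splits_component h37.toProp36Hypotheses v₀ hVt hEt) h37.toProp36Hypotheses.isConnected (ofCharCores_splits_self h37.toProp36Hypotheses v₀ hVt hEt) (ofCharCores_isFinite h37.toProp36Hypotheses v₀ hVt hEt) (ofCharCores_hasNonemptyFibres h37.toProp36Hypotheses v₀ hVt hEt)) PA _ _ _ ρ' baseAct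
        (TemperedPiChart.firstCountableTopology_G ((GaloisLevelData.ofCharCores h37.toProp36Hypotheses v₀ hVt hEt).chart h37.toProp36Hypotheses.isCountable (ofCharCores_exists_level_splits_component h37.toProp36Hypotheses v₀ hVt hEt) h37.toProp36Hypotheses.isConnected (ofCharCores_splits_self h37.toProp36Hypotheses v₀ hVt hEt) (ofCharCores_isFinite h37.toProp36Hypotheses v₀ hVt hEt) (ofCharCores_hasNonemptyFibres h37.toProp36Hypotheses v₀ hVt hEt))) h37.toProp36Hypotheses IsTempered.of_profinite ((GaloisLevelData.ofCharCores h37.toProp36Hypotheses v₀ hVt hEt).piPresentation h37.toProp36Hypotheses.isCountable T R)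
        (isArithCompatible_piPresentation_outerAction_of_branchPair_chart_of_finite (GaloisLevelData.ofCharCores h37.toProp36Hypotheses v₀ hVt hEt) h37.toProp36Hypotheses.isCountable (ofCharCores_exists_level_splits_component h37.toProp36Hypotheses v₀ hVt hEt) h37.toProp36Hypotheses.isConnected (ofCharCores_splits_self h37.toProp36Hypotheses v₀ hVt hEt) (ofCharCores_isFinite h37.toProp36Hypotheses v₀ hVt hEt) (ofCharCores_hasNonemptyFibres h37.toProp36Hypotheses v₀ hVt hEt) T R ρ' baseAct h37 hG hV hBR) w₀
        ((GaloisLevelData.ofCharCores h37.toProp36Hypotheses v₀ hVt hEt).isCompact_piPresentation_H h37.toProp36Hypotheses.isCountable T R w₀) (fun n => ((GaloisLevelData.ofCharCores h37.toProp36Hypotheses v₀ hVt hEt).projAut h37.toProp36Hypotheses.isCountable n).ker) (fun _ => MonoidHom.normal_ker _)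
        ((GaloisLevelData.ofCharCores h37.toProp36Hypotheses v₀ hVt hEt).hKst_and_hLst_of_ker_piLevelAut_eq_charOpenCore h37.toProp36Hypotheses.isCountable (ofCharCores_sameComponent h37.toProp36Hypotheses v₀ hVt hEt) T R ρ' (isArithCompatible_piPresentation_outerAction_of_branchPair_chart_of_finite (GaloisLevelData.ofCharCores h37.toProp36Hypotheses v₀ hVt hEt) h37.toProp36Hypotheses.isCountable (ofCharCores_exists_level_splits_component h37.toProp36Hypotheses v₀ hVt hEt) h37.toProp36Hypotheses.isConnected (ofCharCores_splits_self h37.toProp36Hypotheses v₀ hVt hEt) (ofCharCores_isFinite h37.toProp36Hypotheses v₀ hVt hEt) (ofCharCores_hasNonemptyFibres h37.toProp36Hypotheses v₀ hVt hEt) T R ρ' baseAct h37 hG hV hBR) (fun k : ℕ => k) (GaloisLevelData.ofCharCores_ker_piLevelAut_eq_charOpenCore h37.toProp36Hypotheses v₀ hVt hEt)).1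
        ((GaloisLevelData.ofCharCores h37.toProp36Hypotheses v₀ hVt hEt).ker_projAut_anti h37.toProp36Hypotheses.isCountable) ((GaloisLevelData.ofCharCores h37.toProp36Hypotheses v₀ hVt hEt).isOpen_ker_projAut h37.toProp36Hypotheses.isCountable) (fun _ hU => (GaloisLevelData.ofCharCores h37.toProp36Hypotheses v₀ hVt hEt).exists_ker_projAut_subset h37.toProp36Hypotheses.isCountable hU) ((GaloisLevelData.ofCharCores h37.toProp36Hypotheses v₀ hVt hEt).hK1'_chart_of_eventually_congruenceContinuous h37 (ofCharCores_exists_level_splits_component h37.toProp36Hypotheses v₀ hVt hEt) h37.toProp36Hypotheses.isConnected (ofCharCores_splits_self h37.toProp36Hypotheses v₀ hVt hEt) (ofCharCores_isFinite h37.toProp36Hypotheses v₀ hVt hEt) (ofCharCores_hasNonemptyFibres h37.toProp36Hypotheses v₀ hVt hEt) T R (ofCharCores_sameComponent h37.toProp36Hypotheses v₀ hVt hEt) ρ' baseAct (isArithCompatible_piPresentation_outerAction_of_branchPair_chart_of_finite (GaloisLevelData.ofCharCores h37.toProp36Hypotheses v₀ hVt hEt) h37.toProp36Hypotheses.isCountable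 (ofCharCores_exists_level_splits_component h37.toProp36Hypotheses v₀ hVt hEt) h37.toProp36Hypotheses.isConnected (ofCharCores_splits_self h37.toProp36Hypotheses v₀ hVt hEt) (ofCharCores_isFinite h37.toProp36Hypotheses v₀ hVt hEt) (ofCharCores_hasNonemptyFibres h37.toProp36Hypotheses v₀ hVt hEt) T R ρ' baseAct h37 hG hV hBR) (fun k : ℕ => k) (GaloisLevelData.ofCharCores_ker_piLevelAut_eq_charOpenCore h37.toProp36Hypotheses v₀ hVt hEt) hG n₁ hCC))
    (noSwitchBase : NoBranchSwitching 𝒢.graph.edgeOf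
      (fun (a : PA) (b : 𝒢.graph.Branch) => (baseAct a).hom.branchMap b))
    (hest : IsTotallyArithEstranged (decompositionDataOfChart Rc (toOuterSemidirectProduct ρ')) (outerSemidirectProductSnd ρ')) (hbot : ¬ IsArithAmple (outerSemidirectProductSnd ρ') ⊥) :
    ArithMaximalCompactStatementI (decompositionDataOfChart Rc (toOuterSemidirectProduct ρ')) (outerSemidirectProductSnd ρ') ∧
      ArithMaximalCompactStatementII (decompositionDataOfChart Rc (toOuterSemidirectProduct ρ')) (outerSemidirectProductSnd ρ') :=
  arithMaximalCompactStatement_outerAction_piPresentation_chart_of_designData_hCC_v6 (GaloisLevelData.ofCharCores h37.toProp36Hypotheses v₀ hVt hEt)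
    (ofCharCores_exists_level_splits_component h37.toProp36Hypotheses v₀ hVt hEt) h37.toProp36Hypotheses.isConnected
    (ofCharCores_splits_self h37.toProp36Hypotheses v₀ hVt hEt) (ofCharCores_isFinite h37.toProp36Hypotheses v₀ hVt hEt) (ofCharCores_hasNonemptyFibres h37.toProp36Hypotheses v₀ hVt hEt)
    (ofCharCores_sameComponent h37.toProp36Hypotheses v₀ hVt hEt) h37 hG ρ' baseAct T R Rc hRcV hRcB hV hBR w₀ (fun k : ℕ => k) (GaloisLevelData.ofCharCores_ker_piLevelAut_eq_charOpenCore h37.toProp36Hypotheses v₀ hVt hEt)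
    (faithfulV_ofCharCores v₀ h37 hVt hEt) n₁ hCC hinst noSwitchBase hest hbot

end ProfiniteSemiGraph

end Literature.AnabelianGeometry.SemiGraphs
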